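import Summits.Ventures.Crystal3D.Theorems.StickyWulffConstantCoaxialWallLawExitsOnGrain
import Summits.Ventures.Crystal3D.Theorems.StickyWulffConstantGenericWallFloorGeneralRungNotCoaxial
import Summits.Ventures.Crystal3D.Theorems.StickyWulffConstantGenericWallFloorSharedTriangle
import Summits.Ventures.Crystal3D.Theorems.StickyWulffConstantGenericWallFloorMixedDozenRules
import HarnessLib

/-!
# Exits of a grain are born below the top sample when the linear lattices differ (twin pairs)

HONEST FRAMING. Part of the venture `Summits/Ventures/Crystal3D` (cell `crystal3d-full`), helper
`--supports` the crux `CoaxialWallLaw` (stmt-Ventures-19481, `route-Ventures-StickyWulffConstant`),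
REGISTERED line `WallLedgerF` (planner cf-p1 gen 16), stub `stub_coaxialTwoSlabAdhesion`.
Brick F-N1 (twin case) of the general-filling port, complementing `…CoaxialWallLawExitsOnGrain`
(translation pairs / disjoint grains): for pairs whose LINEAR lattices differ (`A₁·Λ₀ ≠ A₂·Λ₀`, every
twin pair, CSL or not) no `u`-exit of grain 1 — in lane G's sense, arbitrary filling — is born high in the
cell off the rim, because its predecessor's full `A₁`-shell would consist of top-sample balls, forcing all
twelve slots `A₁ w` into `A₂·Λ₀`, i.e. `A₁·Λ₀ = A₂·Λ₀`.  (Lane G's `frame_slots_subset_of_full_shell_top`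
assumes a clean top sliver; here sealing `mem_topSample_of_ge` replaces it on the inner disc.)

* `image_fcc_eq_of_slots_mem` — if all twelve `A₁ w ∈ A₂·Λ₀` then `A₁·Λ₀ = A₂·Λ₀` (slot permutation);
* `slots_mem_of_full_shell_high` — a full `B`-shell ball of height `≥ h + R₀ + 1` off the rim has
  `B w ∈ A₂·Λ₀` for all slots;
* `exit_below_of_linear_ne` — hence a grain-1 exit off the rim has height `< h + R₀ + 2`;
* `card_exits_below_ge_of_linear_ne` — the flux count of such exits (lane G's `card_exits_ge` minus the
  balls of lateral radius `> ρ − 3`).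

Rung credit only; F-C1 not moved.
-/

noncomputable section

namespace Summit.Ventures.Crystal3D.Theorems

open Summit.Ventures.Crystal3D Finset
open Literature.MathematicalPhysics.StatisticalMechanics (fccStacking)
open scoped InnerProductSpace

/-- **Slot inclusion forces equality of linear lattices.** -/
theorem image_fcc_eq_of_slots_mem (A₁ A₂ : EuclideanSpace ℝ (Fin 3) ≃ₗᵢ[ℝ] EuclideanSpace ℝ (Fin 3))
    (h : ∀ w ∈ fccSlots, A₁ w ∈ A₂ '' fccStacking 1 (Real.sqrt (2 / 3))) :
    A₁ '' fccStacking 1 (Real.sqrt (2 / 3)) = A₂ '' fccStacking 1 (Real.sqrt (2 / 3)) := by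
  classical
  refine Set.Subset.antisymm (image_fcc_subset_of_slots_mem A₁ A₂ h)
    (image_fcc_subset_of_slots_mem A₂ A₁ fun s hs => ?_)
  -- the slot permutation `g = A₂⁻¹ ∘ A₁`
  set g : EuclideanSpace ℝ (Fin 3) → EuclideanSpace ℝ (Fin 3) := fun w => A₂.symm (A₁ w) with hg
  have hgS : ∀ w ∈ fccSlots, g w ∈ fccSlots := by
    intro w hw
    obtain ⟨q, hq, hqe⟩ := h w hw
    have hgw : g w = q := by rw [hg]; simp only; rw [← hqe, LinearIsometryEquiv.symm_apply_apply]
    rw [hgw]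
    refine mem_fccSlots_of_unit hq ?_
    have : ‖A₂ q‖ = 1 := by rw [hqe, LinearIsometryEquiv.norm_map, norm_eq_one_of_mem_fccSlots hw]
    rwa [LinearIsometryEquiv.norm_map] at this
  have hinj : Set.InjOn g ↑fccSlots := fun a _ b _ hab => by
    have := congrArg A₂ hab
    simp only [hg, LinearIsometryEquiv.apply_symm_apply] at this
    exact A₁.injective this
  have himg : fccSlots.image g = fccSlots := by
    apply eq_of_subset_of_card_le
    · intro x hx
      obtain ⟨w, hw, rfl⟩ := mem_image.1 hx
      exact hgS w hw
    · rw [card_image_of_injOn hinj]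
  have hs' : s ∈ fccSlots.image g := by rw [himg]; exact hs
  obtain ⟨w, hw, hws⟩ := mem_image.1 hs'
  refine ⟨w, mem_fcc_of_mem_fccSlots hw, ?_⟩
  have := congrArg A₂ hws
  simp only [hg, LinearIsometryEquiv.apply_symm_apply] at this
  exact this

/-- **A full shell high in the cell lies on the top grain.**  If `d ∈ X` with its full `B`-shell has
height `≥ h + R₀ + 1` and lateral radius `≤ ρ − 2`, then every `B w` is a vector of `A₂·Λ₀`. -/
theorem slots_mem_of_full_shell_high
    (A₂ : EuclideanSpace ℝ (Fin 3) ≃ₗᵢ[ℝ] EuclideanSpace ℝ (Fin 3)) (t₂ : EuclideanSpace ℝ (Fin 3))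
    (X P₂ : Finset (EuclideanSpace ℝ (Fin 3))) (R₀ h ρ : ℝ) (hR₀ : 2 ≤ R₀) (hρ : 2 ≤ ρ)
    (hX : ∀ p ∈ X, ∀ q ∈ X, p ≠ q → 1 ≤ dist p q) (hP₂X : P₂ ⊆ X)
    (hcell : ∀ p ∈ X, -(2 * R₀) ≤ p 2 ∧ p 2 ≤ h + 2 * R₀ ∧ p 0 ^ 2 + p 1 ^ 2 ≤ ρ ^ 2)
    (hP₂ : ∀ p, p ∈ P₂ ↔ (p ∈ (fun q => A₂ q + t₂) '' fccStacking 1 (Real.sqrt (2 / 3)) ∧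
      h + R₀ ≤ p 2 ∧ p 2 ≤ h + 2 * R₀ ∧ p 0 ^ 2 + p 1 ^ 2 ≤ ρ ^ 2))
    (B : EuclideanSpace ℝ (Fin 3) ≃ₗᵢ[ℝ] EuclideanSpace ℝ (Fin 3)) {d : EuclideanSpace ℝ (Fin 3)}
    (hd : d ∈ X) (hfull : ∀ w ∈ fccSlots, d + B w ∈ X) (hd2 : h + R₀ + 1 ≤ d 2)
    (hdr : d 0 ^ 2 + d 1 ^ 2 ≤ (ρ - 2) ^ 2) :
    ∀ w ∈ fccSlots, B w ∈ A₂ '' fccStacking 1 (Real.sqrt (2 / 3)) := by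
  intro w hw
  have hw1 : ‖B w‖ = 1 := by rw [LinearIsometryEquiv.norm_map, norm_eq_one_of_mem_fccSlots hw]
  have hρ2 : (0 : ℝ) ≤ ρ - 2 := by linarith
  have hρ1 : (1 : ℝ) ≤ ρ := by linarith
  have htop : ∀ p ∈ X, p 2 ≤ h + 2 * R₀ := fun p hp => (hcell p hp).2.1
  have hdP : d ∈ P₂ := mem_topSample_of_ge A₂ t₂ (h + R₀) (h + 2 * R₀) ρ (by linarith) hρ1 X P₂ hX hP₂X
    hP₂ htop d hd (by linarith) (by nlinarith)
  have h2 : (d + B w) 2 = d 2 + ⟪B w, EuclideanSpace.single (2 : Fin 3) (1 : ℝ)⟫_ℝ := by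
    rw [PiLp.add_apply, apply_two_eq_inner_e₃ (B w)]
  have hα := (abs_le.1 (abs_inner_slot_le_one B hw)).1
  have hlat : (d + B w) 0 ^ 2 + (d + B w) 1 ^ 2 ≤ (ρ - 1) ^ 2 := by
    have := lateral_sq_add_le d (B w) hρ2 hdr
    rw [hw1, show ρ - 2 + 1 = ρ - 1 by ring] at this
    exact this
  have hqP : d + B w ∈ P₂ := mem_topSample_of_ge A₂ t₂ (h + R₀) (h + 2 * R₀) ρ (by linarith) hρ1 X P₂
    hX hP₂X hP₂ htop _ (hfull w hw) (by rw [h2]; linarith) hlat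
  have e : B w = (d + B w) - d := by abel
  rw [e]
  exact sub_mem_image_of_mem_affine A₂ t₂ _ _ ((hP₂ _).1 hqP).1 ((hP₂ _).1 hdP).1

/-- **Exits of grain 1 are born below the top sample** when `A₁·Λ₀ ≠ A₂·Λ₀`.  A `u`-exit `e` of
grain 1 (predecessor `e − A₁ u ∈ X` with full `A₁`-shell) of lateral radius `≤ ρ − 3` has height
`< h + R₀ + 2`. -/
theorem exit_below_of_linear_ne
    (A₁ : EuclideanSpace ℝ (Fin 3) ≃ₗᵢ[ℝ] EuclideanSpace ℝ (Fin 3))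
    (A₂ : EuclideanSpace ℝ (Fin 3) ≃ₗᵢ[ℝ] EuclideanSpace ℝ (Fin 3)) (t₂ : EuclideanSpace ℝ (Fin 3))
    (hlin : A₁ '' fccStacking 1 (Real.sqrt (2 / 3)) ≠ A₂ '' fccStacking 1 (Real.sqrt (2 / 3)))
    (X P₂ : Finset (EuclideanSpace ℝ (Fin 3))) (R₀ h ρ : ℝ) (hR₀ : 2 ≤ R₀) (hρ : 3 ≤ ρ)
    (hX : ∀ p ∈ X, ∀ q ∈ X, p ≠ q → 1 ≤ dist p q) (hP₂X : P₂ ⊆ X)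
    (hcell : ∀ p ∈ X, -(2 * R₀) ≤ p 2 ∧ p 2 ≤ h + 2 * R₀ ∧ p 0 ^ 2 + p 1 ^ 2 ≤ ρ ^ 2)
    (hP₂ : ∀ p, p ∈ P₂ ↔ (p ∈ (fun q => A₂ q + t₂) '' fccStacking 1 (Real.sqrt (2 / 3)) ∧
      h + R₀ ≤ p 2 ∧ p 2 ≤ h + 2 * R₀ ∧ p 0 ^ 2 + p 1 ^ 2 ≤ ρ ^ 2))
    {u : EuclideanSpace ℝ (Fin 3)} (hu : u ∈ fccSlots) {e : EuclideanSpace ℝ (Fin 3)}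
    (hpred : e - A₁ u ∈ X) (hfull : ∀ w ∈ fccSlots, e - A₁ u + A₁ w ∈ X)
    (her : e 0 ^ 2 + e 1 ^ 2 ≤ (ρ - 3) ^ 2) : e 2 < h + R₀ + 2 := by
  by_contra hge
  push Not at hge
  have hρ3 : (0 : ℝ) ≤ ρ - 3 := by linarith
  have hd2 : (e - A₁ u) 2 = e 2 - ⟪A₁ u, EuclideanSpace.single (2 : Fin 3) (1 : ℝ)⟫_ℝ := by
    rw [PiLp.sub_apply, apply_two_eq_inner_e₃ (A₁ u)]
  have hα := (abs_le.1 (abs_inner_slot_le_one A₁ hu)).2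
  have hdr : (e - A₁ u) 0 ^ 2 + (e - A₁ u) 1 ^ 2 ≤ (ρ - 2) ^ 2 := by
    have := lateral_sq_add_le e (-(A₁ u)) hρ3 her
    rw [norm_neg, LinearIsometryEquiv.norm_map, norm_eq_one_of_mem_fccSlots hu,
      show ρ - 3 + 1 = ρ - 2 by ring, ← sub_eq_add_neg] at this
    exact this
  have hall := slots_mem_of_full_shell_high A₂ t₂ X P₂ R₀ h ρ hR₀ (by linarith) hX hP₂X hcell hP₂ A₁
    hpred hfull (by rw [hd2]; linarith) hdr
  exact hlin (image_fcc_eq_of_slots_mem A₁ A₂ hall)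

open scoped Classical in
/-- **F-N1, twin case.**  For `A₁·Λ₀ ≠ A₂·Λ₀` the `u`-exits of grain 1 below height `h + R₀ + 2` number
at least the flux minus the balls of lateral radius `> ρ − 3`. -/
theorem card_exits_below_ge_of_linear_ne
    (A₁ : EuclideanSpace ℝ (Fin 3) ≃ₗᵢ[ℝ] EuclideanSpace ℝ (Fin 3)) (t₁ : EuclideanSpace ℝ (Fin 3))
    (A₂ : EuclideanSpace ℝ (Fin 3) ≃ₗᵢ[ℝ] EuclideanSpace ℝ (Fin 3)) (t₂ : EuclideanSpace ℝ (Fin 3))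
    (hlin : A₁ '' fccStacking 1 (Real.sqrt (2 / 3)) ≠ A₂ '' fccStacking 1 (Real.sqrt (2 / 3)))
    (X P₁ P₂ : Finset (EuclideanSpace ℝ (Fin 3))) (R₀ h ρ : ℝ) (hR₀ : 3 ≤ R₀) (hρ : R₀ ≤ ρ)
    (hX : ∀ p ∈ X, ∀ q ∈ X, p ≠ q → 1 ≤ dist p q) (hP₁X : P₁ ⊆ X) (hP₂X : P₂ ⊆ X)
    (hcell : ∀ p ∈ X, -(2 * R₀) ≤ p 2 ∧ p 2 ≤ h + 2 * R₀ ∧ p 0 ^ 2 + p 1 ^ 2 ≤ ρ ^ 2)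
    (hP₁ : ∀ p, p ∈ P₁ ↔ (p ∈ (fun q => A₁ q + t₁) '' fccStacking 1 (Real.sqrt (2 / 3)) ∧
      -(2 * R₀) ≤ p 2 ∧ p 2 ≤ -R₀ ∧ p 0 ^ 2 + p 1 ^ 2 ≤ ρ ^ 2))
    (hP₂ : ∀ p, p ∈ P₂ ↔ (p ∈ (fun q => A₂ q + t₂) '' fccStacking 1 (Real.sqrt (2 / 3)) ∧
      h + R₀ ≤ p 2 ∧ p 2 ≤ h + 2 * R₀ ∧ p 0 ^ 2 + p 1 ^ 2 ≤ ρ ^ 2))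
    {u : EuclideanSpace ℝ (Fin 3)} (hu : u ∈ fccSlots) :
    Real.sqrt 2 * |⟪A₁ u, EuclideanSpace.single (2 : Fin 3) (1 : ℝ)⟫_ℝ| * Real.pi * (ρ - 1) ^ 2 -
        10 * Real.sqrt 2 * Real.pi * (ρ - 1) -
        (((X.filter fun x => (ρ - 3) ^ 2 < x 0 ^ 2 + x 1 ^ 2).card : ℕ) : ℝ) ≤
      (((X.filter fun e => e 2 < h + R₀ + 2 ∧
          e - A₁ u ∈ X ∧ (∀ w ∈ fccSlots, e - A₁ u + A₁ w ∈ X) ∧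
          ∃ v ∈ fccSlots, e + A₁ v ∉ X).card : ℕ) : ℝ) := by
  have h1 := card_exits_ge A₁ t₁ X P₁ R₀ ρ hR₀ hρ hP₁X hP₁ hu
  set EX := X.filter fun e => e - A₁ u ∈ X ∧ (∀ w ∈ fccSlots, e - A₁ u + A₁ w ∈ X) ∧
      ∃ v ∈ fccSlots, e + A₁ v ∉ X with hEX
  set RIM := X.filter fun x => (ρ - 3) ^ 2 < x 0 ^ 2 + x 1 ^ 2 with hRIM
  set GOOD := X.filter fun e => e 2 < h + R₀ + 2 ∧ e - A₁ u ∈ X ∧ (∀ w ∈ fccSlots, e - A₁ u + A₁ w ∈ X) ∧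
      ∃ v ∈ fccSlots, e + A₁ v ∉ X with hGOOD
  have hsub : EX ⊆ GOOD ∪ RIM := by
    intro e he
    rw [hEX, mem_filter] at he
    obtain ⟨heX, hpred, hfull, hlack⟩ := he
    rw [mem_union]
    by_cases hrim : (ρ - 3) ^ 2 < e 0 ^ 2 + e 1 ^ 2
    · exact Or.inr (mem_filter.2 ⟨heX, hrim⟩)
    · push Not at hrim
      exact Or.inl (mem_filter.2 ⟨heX, exit_below_of_linear_ne A₁ A₂ t₂ hlin X P₂ R₀ h ρ (by linarith)
        (by linarith) hX hP₂X hcell hP₂ hu hpred hfull hrim, hpred, hfull, hlack⟩)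
  have hcard : EX.card ≤ GOOD.card + RIM.card := (card_le_card hsub).trans (card_union_le _ _)
  have h1' : Real.sqrt 2 * |⟪A₁ u, EuclideanSpace.single (2 : Fin 3) (1 : ℝ)⟫_ℝ| * Real.pi * (ρ - 1) ^ 2 -
      10 * Real.sqrt 2 * Real.pi * (ρ - 1) ≤ ((EX.card : ℕ) : ℝ) := by
    convert h1 using 3
  have hcast : ((EX.card : ℕ) : ℝ) ≤ ((GOOD.card : ℕ) : ℝ) + ((RIM.card : ℕ) : ℝ) := by exact_mod_cast hcard
  linarith

end Summit.Ventures.Crystal3D.Theorems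

end
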